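import Summits.CriticalPhenomena.CardyFormulaZ2.Theorems.CardySelfRefinementLagHandOffHalfPlaneTwoArmUndocked
import Mathlib.MeasureTheory.Measure.Real
import HarnessLib

/-!
# The flat-boundary misdock kernel bound: the union bound over windows

Helper for crux stmt-CriticalPhenomena-10268 (`LagHandOff`, line `hitting-tournament`), registered
stub `stub_kernel_flatMisdockBound` — the PROBABILISTIC step of the flat boundary kernel of the
lag hand-off.

Data.  Critical bond percolation on `ℤ²` at mesh `δ`, a boundary row `b`, and the half-discs
`W_z = {v | b ≤ v 1, dist (δ v, δ z) ≤ 4 R}`.  The event bounded here is: SOME site `z` with column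
`z 0 ∈ [j, j + N)` and height `(z 1 - b) δ ≤ H` is the lowest site of its open `W_z`-cluster, that
cluster has all its legs to the row `b - 1` closed, and it reaches distance `3 R` from `z`.

Hypotheses (both taken verbatim as hypotheses of the registered signature).
* `hD` — the flat misdock dictionary (the neighbouring stub `stub_kernel_flatMisdockDictionary`):
  such a cluster forces, for every base point `x` on the line `im x = (b - 1) δ` with
  `dist (δ z, x) + ((z 1 - b) + 3) δ ≤ r` and `4 r ≤ R`, the DUAL alternative of the undocked
  half-plane three-arm event at `(x, r, R)` in the direction `u = -I`.
* `h3` — the undocked polychromatic half-plane three-arm bound (the landed theorem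
  `stub_noTouch_undockedThreeArm`): that event has probability `≤ C (r / R) ^ (1 + α)` whenever
  `u ^ 4 = 1`, `c₀ δ ≤ r`, `K r ≤ R`.

Conclusion: the event has probability `≤ C' (N δ / H + 1) (H / R) ^ (1 + α)` for `H ≥ H₀ δ`,
`R ≥ K' H`, with `C' = C · 3 ^ (1 + α)`, `H₀ = max 8 c₀`, `K' = max 12 (3 K)`.

Proof: cover the column range by the `⌊N δ / H⌋₊ + 1` windows of width `H` with base points
`x_k = (j δ + (k + 1/2) H) + (b - 1) δ · I`.  A site `z` of the event whose column offset
`(z 0 - j) δ` lies in `[k H, (k + 1) H)` is within `H / 2 + ((z 1 - b) + 1) δ` of `x_k`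
(`dist_meshPoint_window_le`), so for `r = 3 H` and `H ≥ 8 δ` the dictionary applies at `x_k`
(`4 r = 12 H ≤ R`), placing `ω` in the three-arm event of the `k`-th window at radii `(3 H, R)`.
The lattice hypothesis `ω ⊆ E(ℤ²)` of the dictionary holds almost surely (`ae_subset_edgeSet`),
and the union bound over the windows (`measureReal_biUnion_finset_le`) with `h3` at
`(x_k, 3 H, R)` and `(3 H / R) ^ (1 + α) = 3 ^ (1 + α) (H / R) ^ (1 + α)` gives the claim.

References: G. F. Lawler, O. Schramm, W. Werner, Electron. J. Probab. 7 (2002), Appendix A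
[LawlerSchrammWernerEJP2002]; S. Smirnov, W. Werner, Math. Res. Lett. 8 (2001), §3
[SmirnovWerner2001].
-/

noncomputable section

open Set Metric Complex MeasureTheory
open Literature.Probability.Percolation Literature.Probability.LatticeModels

namespace Summit.CriticalPhenomena.CardyFormulaZ2.Cruxes.LagHandOff.HittingTournament

/-! ### Elementary helpers -/

/-- `μ.real` is monotone along an almost-sure inclusion, for a finite measure `μ`
(the `Measure.real` form of `measure_mono_ae`). [folklore] -/
theorem measureReal_le_of_ae_imp {Ω : Type*} [MeasurableSpace Ω] {μ : Measure Ω}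
    [IsFiniteMeasure μ] {s t : Set Ω} (h : ∀ᵐ x ∂μ, x ∈ s → x ∈ t) : μ.real s ≤ μ.real t :=
  ENNReal.toReal_mono (measure_ne_top μ t) (measure_mono_ae h)

/-- Window arithmetic: for `0 ≤ t` and `0 < H` the window index `k = ⌊t / H⌋₊` satisfies
`k H ≤ t < (k + 1) H`. [folklore] -/
theorem floor_window_bounds {t H : ℝ} (ht : 0 ≤ t) (hH : 0 < H) :
    (⌊t / H⌋₊ : ℝ) * H ≤ t ∧ t < ((⌊t / H⌋₊ : ℝ) + 1) * H := by
  have h1 : (⌊t / H⌋₊ : ℝ) ≤ t / H := Nat.floor_le (div_nonneg ht hH.le)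
  have h2 : t / H < (⌊t / H⌋₊ : ℝ) + 1 := Nat.lt_floor_add_one _
  constructor
  · calc (⌊t / H⌋₊ : ℝ) * H ≤ t / H * H := mul_le_mul_of_nonneg_right h1 hH.le
      _ = t := div_mul_cancel₀ t hH.ne'
  · calc t = t / H * H := (div_mul_cancel₀ t hH.ne').symm
      _ < ((⌊t / H⌋₊ : ℝ) + 1) * H := mul_lt_mul_of_pos_right h2 hH

/-- The geometric step of the window covering: a site `z` with `b ≤ z 1`, `(z 1 - b) δ ≤ H` and
column offset `(z 0 - j) δ ∈ [k H, (k + 1) H)` satisfies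
`dist (δ z, x) + ((z 1 - b) + 3) δ ≤ 3 H` for the window base point `x`
(`re x = j δ + (k + 1/2) H`, `im x = (b - 1) δ`), as soon as `8 δ ≤ H`:
indeed `dist (δ z, x) ≤ |Δre| + |Δim| ≤ H / 2 + ((z 1 - b) + 1) δ`. [folklore] -/
theorem dist_meshPoint_window_le {δ H : ℝ} {z : Site 2} {j b : ℤ} {k : ℕ} {x : ℂ} (hδ : 0 < δ)
    (hH : 8 * δ ≤ H) (hxre : x.re = (j : ℝ) * δ + ((k : ℝ) + 1 / 2) * H)
    (hxim : x.im = ((b : ℝ) - 1) * δ) (hbz : b ≤ z 1) (hzH : ((z 1 - b : ℤ) : ℝ) * δ ≤ H)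
    (hk1 : (k : ℝ) * H ≤ ((z 0 - j : ℤ) : ℝ) * δ)
    (hk2 : ((z 0 - j : ℤ) : ℝ) * δ < ((k : ℝ) + 1) * H) :
    dist (meshPoint δ z) x + (((z 1 - b : ℤ) : ℝ) + 3) * δ ≤ 3 * H := by
  rw [Complex.dist_eq]
  have h := Complex.norm_le_abs_re_add_abs_im (meshPoint δ z - x)
  rw [Complex.sub_re, Complex.sub_im, meshPoint_re, meshPoint_im, hxre, hxim] at h
  have hbz' : (b : ℝ) ≤ (z 1 : ℝ) := by exact_mod_cast hbz
  push_cast at hzH hk1 hk2 ⊢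
  have hre : |δ * (z 0 : ℝ) - ((j : ℝ) * δ + ((k : ℝ) + 1 / 2) * H)| ≤ H / 2 := by
    rw [abs_le]
    constructor <;> linarith
  have him : |δ * (z 1 : ℝ) - ((b : ℝ) - 1) * δ| = ((z 1 : ℝ) - b) * δ + δ := by
    rw [abs_of_nonneg]
    · ring
    · have : 0 ≤ ((z 1 : ℝ) - b) * δ := mul_nonneg (sub_nonneg.mpr hbz') hδ.le
      linarith
  linarith

/-! ### The registered stub -/

/-- **The flat-boundary misdock kernel bound** (registered stub of the crux `LagHandOff`, line
`hitting-tournament`).  Given the flat misdock dictionary `hD` (a leg-closed half-plane cluster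
with lowest site `z` reaching distance `3 R` inside the half-disc of radius `4 R` forces the dual
undocked three-arm event at every base point `x` of the row `b - 1` with
`dist (δ z, x) + ((z 1 - b) + 3) δ ≤ r`, `4 r ≤ R`) and the undocked polychromatic half-plane
three-arm bound `h3` with exponent `1 + α`, the probability that SOME site `z` with column in
`[j, j + N)` and height `(z 1 - b) δ ≤ H` is the lowest site of such a cluster is at most
`C' (N δ / H + 1) (H / R) ^ (1 + α)` for `H ≥ H₀ δ`, `R ≥ K' H` — a union bound over
`⌊N δ / H⌋₊ + 1` windows of width `H`, the three-arm bound being applied in each window at radii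
`(3 H, R)`. [cite: LawlerSchrammWernerEJP2002, Appendix A] -/
theorem stub_kernel_flatMisdockBound :
    (∀ (ω : BondConfig (Site 2)) (z : Site 2) (b : ℤ) (x : ℂ) (δ r R : ℝ),
      0 < δ → ω ⊆ (zdGraph 2).edgeSet → b ≤ z 1 → x.im = ((b : ℝ) - 1) * δ →
      (∀ w : Site 2, ω ∈ openConnIn {v : Site 2 | b ≤ v 1 ∧ dist (meshPoint δ v) (meshPoint δ z) ≤ 4 * R} z w →
        z 1 ≤ w 1) →
      (∀ w : Site 2, ω ∈ openConnIn {v : Site 2 | b ≤ v 1 ∧ dist (meshPoint δ v) (meshPoint δ z) ≤ 4 * R} z w →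
        w 1 = b → s(w - Pi.single 1 1, w) ∉ ω) →
      (∃ w : Site 2, ω ∈ openConnIn {v : Site 2 | b ≤ v 1 ∧ dist (meshPoint δ v) (meshPoint δ z) ≤ 4 * R} z w ∧
        3 * R ≤ dist (meshPoint δ w) (meshPoint δ z)) →
      dist (meshPoint δ z) x + (((z 1 - b : ℤ) : ℝ) + 3) * δ ≤ r →
      4 * r ≤ R →
      ∃ v₁ w₁ v₂ w₂ : Site 2,
        dist (meshPoint δ v₁) x ≤ 2 * r ∧ dist (meshPoint δ v₂) x ≤ 2 * r ∧
        R / 2 ≤ dist (meshPoint δ w₁) x ∧ R / 2 ≤ dist (meshPoint δ w₂) x ∧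
        dualConfig ω ∈ openConnIn {v : Site 2 | r ≤ dist (meshPoint δ v) x ∧ dist (meshPoint δ v) x ≤ R ∧
            (starRingEnd ℂ (-Complex.I) * (meshPoint δ v - x)).re ≤ 0} v₁ w₁ ∧
        dualConfig ω ∈ openConnIn {v : Site 2 | r ≤ dist (meshPoint δ v) x ∧ dist (meshPoint δ v) x ≤ R ∧
            (starRingEnd ℂ (-Complex.I) * (meshPoint δ v - x)).re ≤ 0} v₂ w₂ ∧
        dualConfig ω ∉ openConnIn {v : Site 2 | r ≤ dist (meshPoint δ v) x ∧ dist (meshPoint δ v) x ≤ R ∧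
            (starRingEnd ℂ (-Complex.I) * (meshPoint δ v - x)).re ≤ 0} v₁ v₂) →
    (∃ C α : ℝ, 0 < C ∧ 0 < α ∧ ∃ c₀ K : ℝ, 0 < c₀ ∧ 1 ≤ K ∧ ∀ u : ℂ, u ^ 4 = 1 →
      ∀ (x : ℂ) (δ r R : ℝ), 0 < δ → c₀ * δ ≤ r → K * r ≤ R → ∀ S : Set (Site 2),
      S = {v | r ≤ dist (meshPoint δ v) x ∧ dist (meshPoint δ v) x ≤ R ∧
        (starRingEnd ℂ u * (meshPoint δ v - x)).re ≤ 0} →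
      (bondPercolation (zdGraph 2) half).real {ω | ∃ v₁ w₁ v₂ w₂ : Site 2,
        dist (meshPoint δ v₁) x ≤ 2 * r ∧ dist (meshPoint δ v₂) x ≤ 2 * r ∧
        R / 2 ≤ dist (meshPoint δ w₁) x ∧ R / 2 ≤ dist (meshPoint δ w₂) x ∧
        ((ω ∈ openConnIn S v₁ w₁ ∧ ω ∈ openConnIn S v₂ w₂ ∧ ω ∉ openConnIn S v₁ v₂) ∨
         (dualConfig ω ∈ openConnIn S v₁ w₁ ∧ dualConfig ω ∈ openConnIn S v₂ w₂ ∧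
          dualConfig ω ∉ openConnIn S v₁ v₂))} ≤ C * (r / R) ^ (1 + α)) →
    ∃ C α : ℝ, 0 < C ∧ 0 < α ∧ ∃ H₀ K : ℝ, 1 ≤ H₀ ∧ 1 ≤ K ∧
      ∀ (δ : ℝ) (b j : ℤ) (N : ℕ) (H R : ℝ), 0 < δ → 1 ≤ N → H₀ * δ ≤ H → K * H ≤ R →
      (bondPercolation (zdGraph 2) half).real {ω | ∃ z : Site 2, j ≤ z 0 ∧ z 0 < j + N ∧ b ≤ z 1 ∧
        ((z 1 - b : ℤ) : ℝ) * δ ≤ H ∧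
        (∀ w : Site 2, ω ∈ openConnIn {v : Site 2 | b ≤ v 1 ∧ dist (meshPoint δ v) (meshPoint δ z) ≤ 4 * R} z w →
          z 1 ≤ w 1) ∧
        (∀ w : Site 2, ω ∈ openConnIn {v : Site 2 | b ≤ v 1 ∧ dist (meshPoint δ v) (meshPoint δ z) ≤ 4 * R} z w →
          w 1 = b → s(w - Pi.single 1 1, w) ∉ ω) ∧
        (∃ w : Site 2, ω ∈ openConnIn {v : Site 2 | b ≤ v 1 ∧ dist (meshPoint δ v) (meshPoint δ z) ≤ 4 * R} z w ∧
          3 * R ≤ dist (meshPoint δ w) (meshPoint δ z))} ≤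
        C * ((N : ℝ) * δ / H + 1) * (H / R) ^ (1 + α) := by
  intro hD h3
  obtain ⟨C, α, hC, hα, c₀, K, hc₀, hK, h3⟩ := h3
  refine ⟨C * 3 ^ (1 + α), α, by positivity, hα, max 8 c₀, max 12 (3 * K),
    le_trans (by norm_num) (le_max_left _ _), le_trans (by norm_num) (le_max_left _ _), ?_⟩
  intro δ b j N H R hδ _hN hH hR
  -- the scales
  have hH8 : 8 * δ ≤ H := le_trans (mul_le_mul_of_nonneg_right (le_max_left _ _) hδ.le) hH
  have hHc : c₀ * δ ≤ H := le_trans (mul_le_mul_of_nonneg_right (le_max_right _ _) hδ.le) hH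
  have hHpos : 0 < H := by linarith [mul_pos (by norm_num : (0 : ℝ) < 8) hδ]
  have hR12 : 12 * H ≤ R := le_trans (mul_le_mul_of_nonneg_right (le_max_left _ _) hHpos.le) hR
  have hRK : 3 * K * H ≤ R := le_trans (mul_le_mul_of_nonneg_right (le_max_right _ _) hHpos.le) hR
  have hRpos : 0 < R := by linarith
  -- the windows: base points `X k`, half-annuli `S k`, three-arm events `E k`, `k ≤ m`
  set m : ℕ := ⌊(N : ℝ) * δ / H⌋₊ with hm
  set X : ℕ → ℂ := fun k => ⟨(j : ℝ) * δ + ((k : ℝ) + 1 / 2) * H, ((b : ℝ) - 1) * δ⟩ with hX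
  set S : ℕ → Set (Site 2) := fun k => {v | 3 * H ≤ dist (meshPoint δ v) (X k) ∧
    dist (meshPoint δ v) (X k) ≤ R ∧ (starRingEnd ℂ (-Complex.I) * (meshPoint δ v - X k)).re ≤ 0} with hS
  set E : ℕ → Set (BondConfig (Site 2)) := fun k => {ω | ∃ v₁ w₁ v₂ w₂ : Site 2,
    dist (meshPoint δ v₁) (X k) ≤ 2 * (3 * H) ∧ dist (meshPoint δ v₂) (X k) ≤ 2 * (3 * H) ∧
    R / 2 ≤ dist (meshPoint δ w₁) (X k) ∧ R / 2 ≤ dist (meshPoint δ w₂) (X k) ∧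
    ((ω ∈ openConnIn (S k) v₁ w₁ ∧ ω ∈ openConnIn (S k) v₂ w₂ ∧ ω ∉ openConnIn (S k) v₁ v₂) ∨
     (dualConfig ω ∈ openConnIn (S k) v₁ w₁ ∧ dualConfig ω ∈ openConnIn (S k) v₂ w₂ ∧
      dualConfig ω ∉ openConnIn (S k) v₁ v₂))} with hE
  -- each window event has probability `≤ C (3 H / R) ^ (1 + α)`
  have hu : (-Complex.I) ^ 4 = 1 := by rw [Even.neg_pow ⟨2, rfl⟩, Complex.I_pow_four]
  have hEk : ∀ k, (bondPercolation (zdGraph 2) half).real (E k) ≤ C * (3 * H / R) ^ (1 + α) :=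
    fun k => h3 (-Complex.I) hu (X k) δ (3 * H) R hδ (by linarith) (by linarith) (S k) rfl
  -- the event is a.s. covered by the window events (dictionary in the window of `z`)
  refine (measureReal_le_of_ae_imp (μ := bondPercolation (zdGraph 2) half)
    (t := ⋃ k ∈ Finset.range (m + 1), E k) ?_).trans ?_
  · filter_upwards [ae_subset_edgeSet (zdGraph 2) half] with ω hω h
    obtain ⟨z, hjz, hzj, hbz, hzH, hlow, hleg, hreach⟩ := h
    have ht0 : 0 ≤ ((z 0 - j : ℤ) : ℝ) * δ :=
      mul_nonneg (by exact_mod_cast sub_nonneg.mpr hjz) hδ.le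
    have hzN : z 0 - j ≤ N := by omega
    have htN : ((z 0 - j : ℤ) : ℝ) * δ ≤ (N : ℝ) * δ :=
      mul_le_mul_of_nonneg_right (by exact_mod_cast hzN) hδ.le
    obtain ⟨hk1, hk2⟩ := floor_window_bounds ht0 hHpos
    have hkm : ⌊((z 0 - j : ℤ) : ℝ) * δ / H⌋₊ ≤ m :=
      Nat.floor_le_floor (div_le_div_of_nonneg_right htN hHpos.le)
    refine Set.mem_iUnion₂.mpr ⟨⌊((z 0 - j : ℤ) : ℝ) * δ / H⌋₊,
      Finset.mem_range.mpr (Nat.lt_succ_of_le hkm), ?_⟩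
    have hdist := dist_meshPoint_window_le (x := X ⌊((z 0 - j : ℤ) : ℝ) * δ / H⌋₊)
      hδ hH8 rfl rfl hbz hzH hk1 hk2
    obtain ⟨v₁, w₁, v₂, w₂, h1, h2, h3', h4, h5, h6, h7⟩ :=
      hD ω z b (X ⌊((z 0 - j : ℤ) : ℝ) * δ / H⌋₊) δ (3 * H) R hδ hω hbz rfl hlow hleg hreach hdist
        (by linarith)
    exact ⟨v₁, w₁, v₂, w₂, h1, h2, h3', h4, Or.inr ⟨h5, h6, h7⟩⟩
  -- the union bound
  calc (bondPercolation (zdGraph 2) half).real (⋃ k ∈ Finset.range (m + 1), E k)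
      ≤ ∑ k ∈ Finset.range (m + 1), (bondPercolation (zdGraph 2) half).real (E k) :=
        measureReal_biUnion_finset_le _ _
    _ ≤ ∑ _k ∈ Finset.range (m + 1), C * (3 * H / R) ^ (1 + α) :=
        Finset.sum_le_sum fun k _ => hEk k
    _ = ((m : ℝ) + 1) * (C * (3 * H / R) ^ (1 + α)) := by
        rw [Finset.sum_const, Finset.card_range, nsmul_eq_mul]
        push_cast
        ring
    _ ≤ ((N : ℝ) * δ / H + 1) * (C * (3 * H / R) ^ (1 + α)) := by
        have hmle : (m : ℝ) ≤ (N : ℝ) * δ / H := Nat.floor_le (by positivity)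
        have h0 : 0 ≤ C * (3 * H / R) ^ (1 + α) := by positivity
        exact mul_le_mul_of_nonneg_right (by linarith) h0
    _ = C * 3 ^ (1 + α) * ((N : ℝ) * δ / H + 1) * (H / R) ^ (1 + α) := by
        rw [show (3 : ℝ) * H / R = 3 * (H / R) by ring,
          Real.mul_rpow (by norm_num : (0 : ℝ) ≤ 3) (by positivity)]
        ring

end Summit.CriticalPhenomena.CardyFormulaZ2.Cruxes.LagHandOff.HittingTournament

end
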